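import Literature.Geometry.Kaehler.ComplexTorusPolarizedProductOfCMEllipticCurvesDegree
import Literature.Geometry.Kaehler.ComplexTorusProductOfCMEllipticCurvesIdealTorsion
import HarnessLib

/-!
# Polarized products of CM elliptic curves, IV: `𝔰`-modular hermitian lattices and Narbonne's
# Remark 1, `deg ρ_h = ((Γ^{α_R})^♯ : 𝔰(Γ^{α_R})^♯) = N(𝔰)^g`

Layer `Literature/Geometry/Kaehler`, namespace `Literature.Geometry.Kaehler.ComplexTorus`; lane
`lit-hodgefound` (Track 2 foundations library), family `hodge`; FILE 2 of the row «Shimura §7.2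
Prop. 10 for index `m` / Narbonne Remark 1» — sequel of
`ComplexTorusPolarizedProductOfCMEllipticCurvesDegree` (Prop. 1: `deg ρ_h = ((Γ^{α_R})^♯ : Γ^{α_R})`;
Remark 1: principal ⟺ unimodular) and of `ComplexTorusProductOfCMEllipticCurvesIdealTorsion`
(`#(Γ : 𝔰)/Γ = #𝔰⁻¹Γ/Γ = N(𝔰)^{dim X}`).  THEOREMS ONLY: no definition, no named fact (net debt `0`).

## Source, VERBATIM

F. Narbonne, *Polarized products of elliptic curves with complex multiplication and field of moduli
`ℚ`*, arXiv:2203.11982 (2022) [Narbonne2022PolarizedProductsCM], held `paper:arxiv-2203.11982` p0007: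

* §2.3: "A hermitian `R`-lattice is defined as couple `(L, H)` with `L` a `R`-lattice and `H` a
  positive definite hermitian form on the ambient space `KL`. The scale of a hermitian lattice
  `(L, H)` is defined as the fractional ideal `𝔰(L) = H(L, L) ⊆ K`. The dual lattice `L^♯` of a
  hermitian lattice is the lattice defined by `L^♯ = {v ∈ V, H(v, L) ⊆ R}`. We say that `(L, H)` is
  `𝔞`-modular if `𝔞L^♯ = L`. If `(L, H)` is `𝔞`-modular then its scale satisfies `𝔰(L) = 𝔞`. […] A
  hermitian lattice `(L, H)` which is `R`-modular is called unimodular, it is equivalent to the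
  conditions `(L, H)` is integral and its scale is `𝔰(L) = (1) = R`."
* "**Proposition 1.** […] `deg ρ_h = ((Γ^{α_R})^♯ : Γ^{α_R})`."
* "**Remark 1.** If moreover the lattice `(Γ^{α_R}, h^{α_R})` is `𝔰(Γ^{α_R})`-modular then
  `deg ρ_h = ((Γ^{α_R})^♯ : 𝔰(Γ^{α_R}).(Γ^{α_R})^♯) = N(𝔰(Γ^{α_R}))^g`.
  Hence, classes of principally polarized tori `(Γ, h)`, i.e., with `deg ρ_h = 1` correspond to
  isometry classes of integral lattices which scale has norm `1` and it is an integral ideal by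
  Proposition 1. So it corresponds to unimodular lattices."
* proof of Theorem 1 (p0006): "If we endow `R^g` with the canonical hermitian form
  `h₀(x, y) = ᵗx ȳ`, we have `h₀(R^g, R^g) = R` […] Thus, `(R^g, (1/α_R) h₀)` defines a polarized torus".

## What is formalised (theorems only), and on which carriers

As in the prequels: `X = E/Ψ(ℤ^ι)`, `K` a number field with an integral basis `b = (1, ω₀)` of
`𝓞_K`, `φ : K →+* ℂ`, `α = Im φ(ω₀) ≠ 0`, `R = φ(𝓞_K) = (φ.comp (algebraMap (𝓞 K) K)).range`, the
lattice `Γ = Ψ(ℤ^ι)` is `R`-stable (`hΛ`), a polarization is `IsRiemannForm Ψ ω` with `h = hermOf ω`.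
The hermitian dual of `(Γ^{α_R}, h^{α_R})` is written DEF-FREE as the predicate
`v ∈ (Γ^α)^♯ :⟺ ∀ m, α·h(v, Ψm) ∈ R`, the lattice quotient `(Γ : 𝔰) = 𝔰⁻¹Γ` as
`∀ s ∈ 𝔰, φ(s)v ∈ Γ` (`ComplexTorusProductOfCMEllipticCurvesIdealTorsion`), and
**`𝔰`-MODULARITY** in the two equivalent forms
(M) `∀ v, v ∈ (Γ^α)^♯ ⟺ v ∈ (Γ : 𝔰)` ("`(Γ^α)^♯ = 𝔰⁻¹Γ^α`") and
(M′) `𝔰·(Γ^α)^♯ = Γ^α` — the subgroup generated by the `φ(s)w`, `s ∈ 𝔰`, `w ∈ (Γ^α)^♯`, is `Γ` —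
the PRINTED definition.

* §1 `(Γ^α)^♯` is an `R`-module containing `Γ` (`mul_hermOf_smul_latticeVec_mem_range`,
  `mul_hermOf_add_latticeVec_mem_range`, `mul_hermOf_neg_latticeVec_mem_range`).
* §2 **`forall_dual_iff_colon_iff_closure_eq`**: for `𝔰 ≠ 0`, (M) ⟺ (M′) (`𝔰` is invertible:
  `1 ∈ 𝔰⁻¹𝔰`; `Γ` and `(Γ^α)^♯` are `R`-modules).
* §3 **REMARK 1: `abs_polarizationDegree_eq_absNorm_pow_of_modular`** — for `K` imaginary quadratic and
  a polarization `ω` whose integral hermitian lattice `(Γ^{α_R}, h^{α_R})` is `𝔰`-modular (M),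
  `|deg ρ_h| = |polarizationDegree Ψ ω| = ((Γ^α)^♯ : Γ^α) = #𝔰⁻¹Γ/Γ = N(𝔰)^{dim X}` (Prop. 1 of the
  prequel + Prop. 10 of FILE 1); `natAbs_det_eq_absNorm_pow_of_modular` (`|det G| = N(𝔰)^{dim X}` for the
  integer Gram matrix); **`kerPhiH_eq_idealTorsion_of_modular`** (`K(ρ_h) = 𝔤(𝔰, X)` for an `(X, ι)`).
* §4 `𝔰 = R`: **`isPrincipalPolarization_iff_forall_dual_iff_colon_top`** — principal ⟺ `R`-modular
  (= unimodular, the prequel's `isPrincipalPolarization_iff_forall_exists_intVec`), and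
  `abs_polarizationDegree_eq_one_of_modular_top` (`N(R)^g = 1`).
* §5 validation on `E_Rⁿ = ℂⁿ/(R × ⋯ × R)`: **`exists_modular_span_natCast_smul`** — for the principal
  `ω₀ = h₀/α_R` of the prequel and `c ≥ 1`, the polarization `c·ω₀` has `(Γ^α, c·h₀)` `(c)`-MODULAR and
  `|deg ρ_{c h₀}| = N((c))^n = c^{2n}`.

## References
* [Narbonne2022PolarizedProductsCM] F. Narbonne, arXiv:2203.11982 (2022), §2.3: Prop. 1, Remark 1,
  Thm. 2; §2.2 Thm. 1 (proof).
* [Shimura1998] G. Shimura, *Abelian Varieties with Complex Multiplication and Modular Functions*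
  (1998), §7.2 Prop. 10 (`ν(λ_𝔞) = N(𝔞)^m`) — via FILE 1.
* [Lange2023AbelianVarietiesComplex] H. Lange, *Abelian Varieties over the Complex Numbers* (2023),
  §1.4.2 Prop. 1.4.7 (`deg φ_L = det Im H = #K(L)`).
-/

noncomputable section

open Module Complex NumberField
open scoped ComplexConjugate nonZeroDivisors Pointwise

namespace Literature.Geometry.Kaehler

namespace ComplexTorus

variable {K : Type} [Field K] (φ : K →+* ℂ)
variable {ι : Type*} {E : Type*} [NormedAddCommGroup E] [NormedSpace ℂ E]

/-! ## §1. The hermitian dual `(Γ^{α_R})^♯ = {v ∈ V, α_R·h(v, Γ) ⊆ R}` is an `R`-module containing `Γ` -/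

section Dual

variable {Ψ : (ι → ℝ) ≃L[ℝ] E} {ω : E [⋀^Fin 2]→L[ℝ] ℝ}

/-- **`(Γ^α)^♯` is `R`-stable**: `α·h(φ(r)v, γ) = φ(r)·α·h(v, γ) ∈ R` (`h` is `ℂ`-linear in the first
slot). [cite: Narbonne2022PolarizedProductsCM, §2.3 (the dual lattice `L^♯` is an `R`-lattice)] -/
theorem mul_hermOf_smul_latticeVec_mem_range (b : Basis (Fin 2) ℤ (𝓞 K)) {v : E}
    (hv : ∀ m : ι → ℤ, ((φ (b 1 : K)).im : ℂ) * hermOf ω v (latticeVec Ψ m) ∈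
      (φ.comp (algebraMap (𝓞 K) K)).range)
    (r : 𝓞 K) (m : ι → ℤ) :
    ((φ (b 1 : K)).im : ℂ) * hermOf ω (φ (r : K) • v) (latticeVec Ψ m) ∈
      (φ.comp (algebraMap (𝓞 K) K)).range := by
  rw [hermOf_smul_left, mul_left_comm]
  exact Subring.mul_mem _ ⟨r, rfl⟩ (hv m)

/-- `(Γ^α)^♯` is closed under addition. [cite: Narbonne2022PolarizedProductsCM, §2.3 (the dual lattice `L^♯`)] -/
theorem mul_hermOf_add_latticeVec_mem_range (b : Basis (Fin 2) ℤ (𝓞 K)) {v w : E}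
    (hv : ∀ m : ι → ℤ, ((φ (b 1 : K)).im : ℂ) * hermOf ω v (latticeVec Ψ m) ∈
      (φ.comp (algebraMap (𝓞 K) K)).range)
    (hw : ∀ m : ι → ℤ, ((φ (b 1 : K)).im : ℂ) * hermOf ω w (latticeVec Ψ m) ∈
      (φ.comp (algebraMap (𝓞 K) K)).range)
    (m : ι → ℤ) :
    ((φ (b 1 : K)).im : ℂ) * hermOf ω (v + w) (latticeVec Ψ m) ∈
      (φ.comp (algebraMap (𝓞 K) K)).range := by
  rw [hermOf_add_left, mul_add]
  exact Subring.add_mem _ (hv m) (hw m)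

/-- `(Γ^α)^♯` is closed under negation. [cite: Narbonne2022PolarizedProductsCM, §2.3 (the dual lattice `L^♯`)] -/
theorem mul_hermOf_neg_latticeVec_mem_range (b : Basis (Fin 2) ℤ (𝓞 K)) {v : E}
    (hv : ∀ m : ι → ℤ, ((φ (b 1 : K)).im : ℂ) * hermOf ω v (latticeVec Ψ m) ∈
      (φ.comp (algebraMap (𝓞 K) K)).range)
    (m : ι → ℤ) :
    ((φ (b 1 : K)).im : ℂ) * hermOf ω (-v) (latticeVec Ψ m) ∈
      (φ.comp (algebraMap (𝓞 K) K)).range := by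
  have h := mul_hermOf_smul_latticeVec_mem_range φ b hv (-1) m
  simpa using h

/-- `0 ∈ (Γ^α)^♯` (the dual lattice is a subgroup). [cite: Narbonne2022PolarizedProductsCM, §2.3 (the dual lattice `L^♯`)] -/
theorem mul_hermOf_zero_latticeVec_mem_range (b : Basis (Fin 2) ℤ (𝓞 K)) (m : ι → ℤ) :
    ((φ (b 1 : K)).im : ℂ) * hermOf ω (0 : E) (latticeVec Ψ m) ∈
      (φ.comp (algebraMap (𝓞 K) K)).range := by
  rw [show (0 : E) = (0 : ℂ) • (0 : E) by rw [zero_smul], hermOf_smul_left, zero_mul, mul_zero]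
  exact Subring.zero_mem _

/-- `Ψ(m + n) = Ψ m + Ψ n` (plumbing). [folklore] -/
private theorem latticeVec_add' (m n : ι → ℤ) :
    latticeVec Ψ (m + n) = latticeVec Ψ m + latticeVec Ψ n := by
  rw [latticeVec, latticeVec, latticeVec, ← map_add]
  congr 1
  funext i
  simp

/-- `Ψ(-m) = -Ψ m` (plumbing). [folklore] -/
private theorem latticeVec_neg' (m : ι → ℤ) : latticeVec Ψ (-m) = -latticeVec Ψ m := by
  rw [latticeVec, latticeVec, ← map_neg]
  congr 1
  funext i
  simp

/-- `Ψ(0) = 0` (plumbing). [folklore] -/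
private theorem latticeVec_zero' : latticeVec Ψ (0 : ι → ℤ) = 0 := by
  have h0 : (fun i ↦ (((0 : ι → ℤ) i : ℤ) : ℝ)) = 0 := funext fun i ↦ by simp
  rw [latticeVec, h0, map_zero]

end Dual

/-! ## §2. `𝔰`-modularity: the printed `𝔰(Γ^α)^♯ = Γ^α` ⟺ `(Γ^α)^♯ = (Γ : 𝔰) = 𝔰⁻¹Γ` -/

section Modular

variable [NumberField K] {Ψ : (ι → ℝ) ≃L[ℝ] E} {ω : E [⋀^Fin 2]→L[ℝ] ℝ}

/-- `1 ∈ 𝔰⁻¹𝔰`: induction principle — an additive predicate on `K` holding at all products `t·s`,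
`t ∈ 𝔰⁻¹`, `s ∈ 𝔰`, holds at `1` (`𝔰 ≠ 0` is invertible in the Dedekind domain `𝓞_K`). [folklore] -/
private theorem induction_one_of_inv_mul {𝔰 : Ideal (𝓞 K)} (h𝔰 : 𝔰 ≠ ⊥) {P : K → Prop}
    (hmul : ∀ t ∈ ((𝔰 : FractionalIdeal (𝓞 K)⁰ K)⁻¹ : FractionalIdeal (𝓞 K)⁰ K), ∀ s ∈ 𝔰,
      P (t * algebraMap (𝓞 K) K s))
    (hadd : ∀ x y, P x → P y → P (x + y)) : P 1 := by
  have h𝔰0 : (𝔰 : FractionalIdeal (𝓞 K)⁰ K) ≠ 0 := FractionalIdeal.coeIdeal_ne_zero.mpr h𝔰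
  have h1 : (1 : K) ∈ (((𝔰 : FractionalIdeal (𝓞 K)⁰ K)⁻¹ * (𝔰 : FractionalIdeal (𝓞 K)⁰ K) :
      FractionalIdeal (𝓞 K)⁰ K) : Submodule (𝓞 K) K) := by
    rw [inv_mul_cancel₀ h𝔰0, FractionalIdeal.coe_one]
    exact Submodule.mem_one.mpr ⟨1, map_one _⟩
  rw [FractionalIdeal.coe_mul] at h1
  refine Submodule.mul_induction_on h1 (fun t ht s hs ↦ ?_) hadd
  obtain ⟨s', hs', rfl⟩ := (FractionalIdeal.mem_coeIdeal _).mp hs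
  exact hmul t ht s' hs'

/-- `t·s ∈ 𝓞_K` for `t ∈ 𝔰⁻¹`, `s ∈ 𝔰`. [folklore] -/
private theorem exists_eq_mul_of_mem_inv {𝔰 : Ideal (𝓞 K)} {t : K}
    (ht : t ∈ ((𝔰 : FractionalIdeal (𝓞 K)⁰ K)⁻¹ : FractionalIdeal (𝓞 K)⁰ K)) {s : 𝓞 K} (hs : s ∈ 𝔰) :
    ∃ r : 𝓞 K, (r : K) = t * algebraMap (𝓞 K) K s := by
  have h : t * algebraMap (𝓞 K) K s ∈ (((𝔰 : FractionalIdeal (𝓞 K)⁰ K)⁻¹ *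
      (𝔰 : FractionalIdeal (𝓞 K)⁰ K) : FractionalIdeal (𝓞 K)⁰ K)) :=
    FractionalIdeal.mul_mem_mul ht (FractionalIdeal.mem_coeIdeal_of_mem _ hs)
  have hle : ((𝔰 : FractionalIdeal (𝓞 K)⁰ K)⁻¹ * (𝔰 : FractionalIdeal (𝓞 K)⁰ K) :
      FractionalIdeal (𝓞 K)⁰ K) ≤ 1 := by
    by_cases h0 : (𝔰 : FractionalIdeal (𝓞 K)⁰ K) = 0
    · rw [h0, mul_zero]; exact bot_le
    · rw [inv_mul_cancel₀ h0]
  obtain ⟨r, hr⟩ := (FractionalIdeal.mem_one_iff _).mp (hle h)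
  exact ⟨r, hr⟩

/-- **`𝔰`-modularity, printed form ⟺ `(Γ^α)^♯ = 𝔰⁻¹Γ`.**  For a torus with `R`-stable lattice `Γ`,
any real `2`-form `ω` (`h = hermOf ω`) and a non-zero integral ideal `𝔰`: the subgroup generated by
`{φ(s)w : s ∈ 𝔰, w ∈ (Γ^α)^♯}` ("`𝔰L^♯`") EQUALS `Γ` — "`(L, H)` is `𝔞`-modular if `𝔞L^♯ = L`" —
iff for every `v ∈ V`: `v ∈ (Γ^α)^♯ ⟺ φ(𝔰)v ⊆ Γ` (i.e. `(Γ^α)^♯ = (Γ : 𝔰) = 𝔰⁻¹Γ`, multiplying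
`𝔰L^♯ = L` by the inverse ideal: `1 ∈ 𝔰⁻¹𝔰`, and `Γ`, `(Γ^α)^♯` are `R`-modules).
[cite: Narbonne2022PolarizedProductsCM, §2.3 (definition of `𝔞`-modular; Remark 1)] -/
theorem forall_dual_iff_colon_iff_closure_eq (b : Basis (Fin 2) ℤ (𝓞 K))
    (hΛ : ∀ (a : 𝓞 K) (m : ι → ℤ), ∃ m' : ι → ℤ, (φ (a : K)) • latticeVec Ψ m = latticeVec Ψ m')
    {𝔰 : Ideal (𝓞 K)} (h𝔰 : 𝔰 ≠ ⊥) :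
    (∀ v : E, (∀ m : ι → ℤ, ((φ (b 1 : K)).im : ℂ) * hermOf ω v (latticeVec Ψ m) ∈
        (φ.comp (algebraMap (𝓞 K) K)).range) ↔
      ∀ s ∈ 𝔰, ∃ m : ι → ℤ, φ (s : K) • v = latticeVec Ψ m) ↔
    (∀ u : E, u ∈ AddSubgroup.closure {u : E | ∃ s ∈ 𝔰, ∃ w : E,
        (∀ m : ι → ℤ, ((φ (b 1 : K)).im : ℂ) * hermOf ω w (latticeVec Ψ m) ∈
          (φ.comp (algebraMap (𝓞 K) K)).range) ∧ u = φ (s : K) • w} ↔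
      ∃ m : ι → ℤ, u = latticeVec Ψ m) := by
  -- notation: `D v` = `v ∈ (Γ^α)^♯`, `S` = the generators `φ(s)w`
  set D : E → Prop := fun v ↦ ∀ m : ι → ℤ, ((φ (b 1 : K)).im : ℂ) * hermOf ω v (latticeVec Ψ m) ∈
    (φ.comp (algebraMap (𝓞 K) K)).range with hD
  set S : Set E := {u : E | ∃ s ∈ 𝔰, ∃ w : E, D w ∧ u = φ (s : K) • w} with hS
  constructor
  · -- (M) ⟹ (M′)
    intro hM u
    constructor
    · -- `closure S ⊆ Γ`
      intro hu
      induction hu using AddSubgroup.closure_induction with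
      | mem x hx =>
        obtain ⟨s, hs, w, hw, rfl⟩ := hx
        exact (hM w).1 hw s hs
      | zero => exact ⟨0, latticeVec_zero'.symm⟩
      | add x y _ _ hx hy =>
        obtain ⟨m, rfl⟩ := hx
        obtain ⟨m', rfl⟩ := hy
        exact ⟨m + m', (latticeVec_add' m m').symm⟩
      | neg x _ hx =>
        obtain ⟨m, rfl⟩ := hx
        exact ⟨-m, (latticeVec_neg' m).symm⟩
    · -- `Γ ⊆ closure S`: `γ = Σ φ(sⱼ)(φ(tⱼ)γ)` with `φ(tⱼ)γ ∈ (Γ^α)^♯`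
      rintro ⟨m, rfl⟩
      have key : ∀ t ∈ ((𝔰 : FractionalIdeal (𝓞 K)⁰ K)⁻¹ : FractionalIdeal (𝓞 K)⁰ K), ∀ s ∈ 𝔰,
          φ (t * algebraMap (𝓞 K) K s) • latticeVec Ψ m ∈ AddSubgroup.closure S := by
        intro t ht s hs
        -- `w = φ(t)Ψm ∈ (Γ^α)^♯`: `φ(s')φ(t)Ψm = φ(r)Ψm ∈ Γ` for `s' ∈ 𝔰`
        have hw : D (φ t • latticeVec Ψ m) := by
          refine (hM _).2 fun s' hs' ↦ ?_
          obtain ⟨r, hr⟩ := exists_eq_mul_of_mem_inv ht hs'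
          obtain ⟨m', hm'⟩ := hΛ r m
          refine ⟨m', ?_⟩
          rw [smul_smul, ← map_mul, ← hm', mul_comm, ← hr]
        rw [map_mul, mul_comm, mul_smul]
        exact AddSubgroup.subset_closure ⟨s, hs, _, hw, rfl⟩
      have h1 := induction_one_of_inv_mul (K := K) h𝔰
        (P := fun x ↦ φ x • latticeVec Ψ m ∈ AddSubgroup.closure S) key
        (fun x y hx hy ↦ by
          simp only [map_add, add_smul]
          exact AddSubgroup.add_mem _ hx hy)
      simpa using h1
  · -- (M′) ⟹ (M)
    intro hM' v
    constructor
    · intro hv s hs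
      exact (hM' _).1 (AddSubgroup.subset_closure ⟨s, hs, v, hv, rfl⟩)
    · intro hT
      -- `D (φ(t s) v)` for `t ∈ 𝔰⁻¹`, `s ∈ 𝔰`: `φ(s)v ∈ Γ = closure S`, and `φ(t)·closure S ⊆ (Γ^α)^♯`
      have key : ∀ t ∈ ((𝔰 : FractionalIdeal (𝓞 K)⁰ K)⁻¹ : FractionalIdeal (𝓞 K)⁰ K), ∀ s ∈ 𝔰,
          D (φ (t * algebraMap (𝓞 K) K s) • v) := by
        intro t ht s hs
        obtain ⟨m, hm⟩ := hT s hs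
        have hmem : latticeVec Ψ m ∈ AddSubgroup.closure S := (hM' _).2 ⟨m, rfl⟩
        have hcl : ∀ u ∈ AddSubgroup.closure S, D (φ t • u) := by
          intro u hu
          induction hu using AddSubgroup.closure_induction with
          | mem x hx =>
            obtain ⟨s', hs', w, hw, rfl⟩ := hx
            obtain ⟨r, hr⟩ := exists_eq_mul_of_mem_inv ht hs'
            rw [smul_smul, ← map_mul, ← hr]
            exact mul_hermOf_smul_latticeVec_mem_range φ b hw r
          | zero =>
            rw [smul_zero]
            exact mul_hermOf_zero_latticeVec_mem_range φ b
          | add x y _ _ hx hy =>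
            rw [smul_add]
            exact mul_hermOf_add_latticeVec_mem_range φ b hx hy
          | neg x _ hx =>
            rw [smul_neg]
            exact mul_hermOf_neg_latticeVec_mem_range φ b hx
        have h := hcl _ hmem
        rw [← hm, smul_smul, ← map_mul] at h
        simpa only [RingOfIntegers.coe_eq_algebraMap, mul_comm t] using h
      have h1 := induction_one_of_inv_mul (K := K) h𝔰 (P := fun x ↦ D (φ x • v)) key
        (fun x y hx hy ↦ by
          rw [map_add, add_smul]
          exact mul_hermOf_add_latticeVec_mem_range φ b hx hy)
      simpa [hD] using h1

end Modular

/-! ## §3. REMARK 1: `deg ρ_h = ((Γ^{α_R})^♯ : 𝔰(Γ^{α_R})^♯) = N(𝔰)^g` for an `𝔰`-modular lattice -/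

section Remark

variable [NumberField K] [Fintype ι] [DecidableEq ι] {Ψ : (ι → ℝ) ≃L[ℝ] E}
  {ω : E [⋀^Fin 2]→L[ℝ] ℝ}

omit [Fintype ι] [DecidableEq ι] in
/-- `[K : ℚ] = 2` from an integral basis indexed by `Fin 2`. [folklore] -/
private theorem finrank_eq_two_of_basis (b : Basis (Fin 2) ℤ (𝓞 K)) : finrank ℚ K = 2 := by
  rw [← RingOfIntegers.rank, finrank_eq_card_basis b, Fintype.card_fin]

omit [NumberField K] [Fintype ι] [DecidableEq ι] in
/-- `#((Γ^α)^♯/Γ) = #(𝔰⁻¹Γ/Γ)` for an `𝔰`-modular lattice: the two point-counts agree (the points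
`π(Ψx)` with `α·h(Ψx, Γ) ⊆ R` are the points `π(v)` with `φ(𝔰)v ⊆ Γ`). [cite: Narbonne2022PolarizedProductsCM, §2.3 Remark 1] -/
theorem natCard_setOf_forall_mul_hermOf_mem_eq_of_modular (b : Basis (Fin 2) ℤ (𝓞 K))
    {𝔰 : Ideal (𝓞 K)}
    (hmod : ∀ v : E, (∀ m : ι → ℤ, ((φ (b 1 : K)).im : ℂ) * hermOf ω v (latticeVec Ψ m) ∈
        (φ.comp (algebraMap (𝓞 K) K)).range) ↔
      ∀ s ∈ 𝔰, ∃ m : ι → ℤ, φ (s : K) • v = latticeVec Ψ m) :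
    Nat.card {t : ComplexTorus Ψ // ∃ x : ι → ℝ, proj Ψ x = t ∧
      ∀ m : ι → ℤ, ((φ (b 1 : K)).im : ℂ) * hermOf ω (Ψ x) (latticeVec Ψ m) ∈
        (φ.comp (algebraMap (𝓞 K) K)).range} =
    Nat.card {t : ComplexTorus Ψ // ∃ v : E, cover Ψ v = t ∧
      ∀ s ∈ 𝔰, ∃ m : ι → ℤ, φ (s : K) • v = latticeVec Ψ m} := by
  refine Nat.card_congr (Equiv.subtypeEquivRight fun t ↦ ?_)
  constructor
  · rintro ⟨x, rfl, hx⟩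
    exact ⟨Ψ x, cover_apply_apply Ψ x, (hmod _).1 hx⟩
  · rintro ⟨v, rfl, hv⟩
    refine ⟨Ψ.symm v, rfl, ?_⟩
    rw [ContinuousLinearEquiv.apply_symm_apply]
    exact (hmod v).2 hv

/-- **Narbonne 2022, Remark 1: "If moreover the lattice `(Γ^{α_R}, h^{α_R})` is `𝔰(Γ^{α_R})`-modular
then `deg ρ_h = ((Γ^{α_R})^♯ : 𝔰(Γ^{α_R}).(Γ^{α_R})^♯) = N(𝔰(Γ^{α_R}))^g`."**  For `K` imaginary
quadratic (`b = (1, ω₀)`, `α = Im φ(ω₀) ≠ 0`), a polarization `ω` of a torus `X = E/Γ` of dimension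
`g` with `R`-stable lattice whose integral hermitian lattice `(Γ^{α_R}, h^{α_R})` is `𝔰`-MODULAR
(`(Γ^α)^♯ = 𝔰⁻¹Γ`, §2) has `|deg ρ_h| = |det E| = ((Γ^α)^♯ : Γ^α) = #𝔰⁻¹Γ/Γ = N(𝔰)^g`
(Prop. 1 of the prequel, then Shimura's Prop. 10 of FILE 1).
[cite: Narbonne2022PolarizedProductsCM, §2.3 Remark 1 (with Prop. 1)]
[cite: Shimura1998, §7.2 Prop. 10 (`#𝔤(𝔰, X) = N(𝔰)^m`), p. 53] -/
theorem abs_polarizationDegree_eq_absNorm_pow_of_modular [FiniteDimensional ℂ E]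
    (b : Basis (Fin 2) ℤ (𝓞 K)) (hb : b 0 = 1) (hφ : (φ (b 1 : K)).im ≠ 0)
    (hω : IsRiemannForm Ψ ω)
    (hΛ : ∀ (a : 𝓞 K) (m : ι → ℤ), ∃ m' : ι → ℤ, (φ (a : K)) • latticeVec Ψ m = latticeVec Ψ m')
    {𝔰 : Ideal (𝓞 K)} (h𝔰 : 𝔰 ≠ ⊥)
    (hmod : ∀ v : E, (∀ m : ι → ℤ, ((φ (b 1 : K)).im : ℂ) * hermOf ω v (latticeVec Ψ m) ∈
        (φ.comp (algebraMap (𝓞 K) K)).range) ↔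
      ∀ s ∈ 𝔰, ∃ m : ι → ℤ, φ (s : K) • v = latticeVec Ψ m) :
    |polarizationDegree Ψ ω| = (Ideal.absNorm 𝔰 : ℝ) ^ finrank ℂ E := by
  rw [← natCard_setOf_forall_mul_hermOf_mem_eq_abs_polarizationDegree φ b hb hφ hω hΛ,
    natCard_setOf_forall_mul_hermOf_mem_eq_of_modular φ b hmod,
    natCard_setOf_forall_smul_eq_eq_absNorm_pow_finrank φ Ψ (finrank_eq_two_of_basis b) hΛ h𝔰]
  push_cast
  rfl

/-- **Remark 1 for the integer Gram matrix: `deg ρ_h = |det G| = N(𝔰)^g`** for an `𝔰`-modular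
`(Γ^{α_R}, h^{α_R})` (`G` the matrix of `ω` on the lattice basis, Lange Prop. 1.4.7).
[cite: Narbonne2022PolarizedProductsCM, §2.3 Remark 1] [cite: Lange2023AbelianVarietiesComplex, §1.4.2 Prop. 1.4.7] -/
theorem natAbs_det_eq_absNorm_pow_of_modular [FiniteDimensional ℂ E]
    (b : Basis (Fin 2) ℤ (𝓞 K)) (hb : b 0 = 1) (hφ : (φ (b 1 : K)).im ≠ 0)
    (hω : IsRiemannForm Ψ ω)
    (hΛ : ∀ (a : 𝓞 K) (m : ι → ℤ), ∃ m' : ι → ℤ, (φ (a : K)) • latticeVec Ψ m = latticeVec Ψ m')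
    {G : Matrix ι ι ℤ} (hG : G.map (Int.cast : ℤ → ℝ) = latticeGram Ψ ω)
    {𝔰 : Ideal (𝓞 K)} (h𝔰 : 𝔰 ≠ ⊥)
    (hmod : ∀ v : E, (∀ m : ι → ℤ, ((φ (b 1 : K)).im : ℂ) * hermOf ω v (latticeVec Ψ m) ∈
        (φ.comp (algebraMap (𝓞 K) K)).range) ↔
      ∀ s ∈ 𝔰, ∃ m : ι → ℤ, φ (s : K) • v = latticeVec Ψ m) :
    G.det.natAbs = Ideal.absNorm 𝔰 ^ finrank ℂ E := by
  rw [← natCard_setOf_forall_mul_hermOf_mem φ b hb hφ hω hΛ hG,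
    natCard_setOf_forall_mul_hermOf_mem_eq_of_modular φ b hmod,
    natCard_setOf_forall_smul_eq_eq_absNorm_pow_finrank φ Ψ (finrank_eq_two_of_basis b) hΛ h𝔰]

variable {ρ : 𝓞 K →+* Matrix ι ι ℤ}

omit [NumberField K] in
/-- **`K(ρ_h) = 𝔤(𝔰, X)` for an `𝔰`-modular `(Γ^{α_R}, h^{α_R})`**: on an `(X, ι)` (the action `ρ`
with analytic representation `φ`), the kernel `K(h) = (Γ^α)^♯/Γ` of the polarization `ρ_h` IS the
group of `𝔰`-section points `𝔰⁻¹Γ/Γ` — "`deg ρ_h = ((Γ^α)^♯ : 𝔰(Γ^α)^♯)`" as an equality of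
subgroups of `X`. [cite: Narbonne2022PolarizedProductsCM, §2.3 Remark 1 (with Prop. 1)]
[cite: Shimura1998, §7.1 Prop. 8 (`Ker λ = 𝔤(𝔞, A)`), p. 50] -/
theorem kerPhiH_eq_idealTorsion_of_modular (b : Basis (Fin 2) ℤ (𝓞 K)) (hb : b 0 = 1)
    (hφ : (φ (b 1 : K)).im ≠ 0) (hω : IsRiemannForm Ψ ω)
    (hρ : ∀ (a : 𝓞 K) (x : ι → ℝ),
      Ψ (((ρ a).map (Int.cast : ℤ → ℝ)).mulVec x) = φ (a : K) • Ψ x)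
    {G : Matrix ι ι ℤ} (hG : G.map (Int.cast : ℤ → ℝ) = latticeGram Ψ ω)
    {𝔰 : Ideal (𝓞 K)}
    (hmod : ∀ v : E, (∀ m : ι → ℤ, ((φ (b 1 : K)).im : ℂ) * hermOf ω v (latticeVec Ψ m) ∈
        (φ.comp (algebraMap (𝓞 K) K)).range) ↔
      ∀ s ∈ 𝔰, ∃ m : ι → ℤ, φ (s : K) • v = latticeVec Ψ m) :
    kerPhiH Ψ G = idealTorsion Ψ ρ 𝔰 := by
  have hΛ : ∀ (a : 𝓞 K) (m : ι → ℤ), ∃ m' : ι → ℤ,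
      (φ (a : K)) • latticeVec Ψ m = latticeVec Ψ m' :=
    fun a m ↦ ⟨_, smul_latticeVec_eq_of_analyticRep φ hρ a m⟩
  ext t
  obtain ⟨v, rfl⟩ := cover_surjective Ψ t
  rw [cover_mem_idealTorsion_iff_forall_smul_eq φ hρ, ← hmod, cover_apply,
    proj_mem_kerPhiH_iff_forall_mul_hermOf_mem φ b hb hφ hω hΛ hG, ContinuousLinearEquiv.apply_symm_apply]

/-- **Remark 1 on an `(X, ι)`, degree form**: `deg ρ_h = #K(ρ_h) = #𝔤(𝔰, X) = N(𝔰)^{dim X}`.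
[cite: Narbonne2022PolarizedProductsCM, §2.3 Remark 1] [cite: Shimura1998, §7.2 Prop. 10, p. 53] -/
theorem natCard_kerPhiH_eq_absNorm_pow_of_modular [FiniteDimensional ℂ E]
    (b : Basis (Fin 2) ℤ (𝓞 K)) (hb : b 0 = 1) (hφ : (φ (b 1 : K)).im ≠ 0) (hω : IsRiemannForm Ψ ω)
    (hρ : ∀ (a : 𝓞 K) (x : ι → ℝ),
      Ψ (((ρ a).map (Int.cast : ℤ → ℝ)).mulVec x) = φ (a : K) • Ψ x)
    {G : Matrix ι ι ℤ} (hG : G.map (Int.cast : ℤ → ℝ) = latticeGram Ψ ω)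
    {𝔰 : Ideal (𝓞 K)} (h𝔰 : 𝔰 ≠ ⊥)
    (hmod : ∀ v : E, (∀ m : ι → ℤ, ((φ (b 1 : K)).im : ℂ) * hermOf ω v (latticeVec Ψ m) ∈
        (φ.comp (algebraMap (𝓞 K) K)).range) ↔
      ∀ s ∈ 𝔰, ∃ m : ι → ℤ, φ (s : K) • v = latticeVec Ψ m) :
    Nat.card (kerPhiH Ψ G) = Ideal.absNorm 𝔰 ^ finrank ℂ E := by
  rw [kerPhiH_eq_idealTorsion_of_modular φ b hb hφ hω hρ hG hmod,
    natCard_idealTorsion_eq_absNorm_pow_finrank φ (finrank_eq_two_of_basis b) hρ h𝔰]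

end Remark

/-! ## §4. `𝔰 = R`: principally polarized ⟺ `(Γ^{α_R}, h^{α_R})` is `R`-modular (unimodular) -/

section Unimodular

variable [NumberField K] [Fintype ι] [DecidableEq ι]

omit [NumberField K] in
/-- **Remark 1, second half, with `𝔰 = R`: "classes of principally polarized tori […] correspond to
[…] unimodular lattices"** — `ω` is a PRINCIPAL polarization iff it is a polarization and
`(Γ^{α_R}, h^{α_R})` is `R`-MODULAR, `(Γ^α)^♯ = R⁻¹Γ = Γ` ("a hermitian lattice which is `R`-modular
is called unimodular"; the prequel's `isPrincipalPolarization_iff_forall_exists_intVec` in the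
modular language of §2). [cite: Narbonne2022PolarizedProductsCM, §2.3 Remark 1 and the definition of unimodular] -/
theorem isPrincipalPolarization_iff_forall_dual_iff_colon_top (b : Basis (Fin 2) ℤ (𝓞 K))
    (hb : b 0 = 1) (hφ : (φ (b 1 : K)).im ≠ 0) (Ψ : (ι → ℝ) ≃L[ℝ] E)
    (hΛ : ∀ (a : 𝓞 K) (m : ι → ℤ), ∃ m' : ι → ℤ, (φ (a : K)) • latticeVec Ψ m = latticeVec Ψ m')
    (ω : E [⋀^Fin 2]→L[ℝ] ℝ) :
    IsPrincipalPolarization Ψ ω ↔ IsRiemannForm Ψ ω ∧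
      ∀ v : E, (∀ m : ι → ℤ, ((φ (b 1 : K)).im : ℂ) * hermOf ω v (latticeVec Ψ m) ∈
          (φ.comp (algebraMap (𝓞 K) K)).range) ↔
        ∀ s ∈ (⊤ : Ideal (𝓞 K)), ∃ m : ι → ℤ, φ (s : K) • v = latticeVec Ψ m := by
  rw [isPrincipalPolarization_iff_forall_exists_intVec φ b hb hφ Ψ hΛ ω]
  refine and_congr_right fun hR ↦ ⟨fun h v ↦ ⟨fun hv s _ ↦ ?_, fun hv m ↦ ?_⟩, fun h x hx ↦ ?_⟩
  · -- `v ∈ (Γ^α)^♯ ⇒ φ(s)v ∈ (Γ^α)^♯ ⇒ φ(s)v ∈ Γ` (unimodular)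
    have hsv := mul_hermOf_smul_latticeVec_mem_range φ b hv s
    obtain ⟨k, hk⟩ := h (Ψ.symm (φ (s : K) • v)) (by
      simpa only [ContinuousLinearEquiv.apply_symm_apply] using hsv)
    refine ⟨k, ?_⟩
    rw [show latticeVec Ψ k = Ψ (intVec k) from rfl, ← hk, ContinuousLinearEquiv.apply_symm_apply]
  · -- `φ(1)v = v ∈ Γ ⇒ v ∈ (Γ^α)^♯` (integrality of `(Γ^α, h^α)`)
    obtain ⟨m₀, hm₀⟩ := hv 1 Submodule.mem_top
    have hv₀ : v = latticeVec Ψ m₀ := by simpa using hm₀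
    rw [hv₀]
    exact hR.mul_hermOf_latticeVec_mem φ b hb hφ hΛ m₀ m
  · -- `(Γ^α)^♯ = Γ`: `Ψx ∈ (Γ^α)^♯ ⇒ φ(1)Ψx ∈ Γ`
    obtain ⟨k, hk⟩ := (h (Ψ x)).1 hx 1 Submodule.mem_top
    refine ⟨k, Ψ.injective ?_⟩
    rw [show Ψ (intVec k) = latticeVec Ψ k from rfl, ← hk]
    simp

/-- **`deg ρ_h = N(R)^g = 1` for an `R`-modular (unimodular) `(Γ^{α_R}, h^{α_R})`** — Remark 1 at
`𝔰 = R` returns the principal case. [cite: Narbonne2022PolarizedProductsCM, §2.3 Remark 1] -/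
theorem abs_polarizationDegree_eq_one_of_modular_top [FiniteDimensional ℂ E]
    (b : Basis (Fin 2) ℤ (𝓞 K)) (hb : b 0 = 1) (hφ : (φ (b 1 : K)).im ≠ 0)
    {Ψ : (ι → ℝ) ≃L[ℝ] E} {ω : E [⋀^Fin 2]→L[ℝ] ℝ} (hω : IsRiemannForm Ψ ω)
    (hΛ : ∀ (a : 𝓞 K) (m : ι → ℤ), ∃ m' : ι → ℤ, (φ (a : K)) • latticeVec Ψ m = latticeVec Ψ m')
    (hmod : ∀ v : E, (∀ m : ι → ℤ, ((φ (b 1 : K)).im : ℂ) * hermOf ω v (latticeVec Ψ m) ∈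
        (φ.comp (algebraMap (𝓞 K) K)).range) ↔
      ∀ s ∈ (⊤ : Ideal (𝓞 K)), ∃ m : ι → ℤ, φ (s : K) • v = latticeVec Ψ m) :
    |polarizationDegree Ψ ω| = 1 := by
  rw [abs_polarizationDegree_eq_absNorm_pow_of_modular φ b hb hφ hω hΛ
    (by simp : (⊤ : Ideal (𝓞 K)) ≠ ⊥) hmod, Ideal.absNorm_top, Nat.cast_one, one_pow]

end Unimodular

/-! ## §5. Validation on `E_Rⁿ = ℂⁿ/(R × ⋯ × R)`: `(Γ^α, c·h₀)` is `(c)`-modular of degree `c^{2n}` -/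

section Standard

variable [NumberField K] [Fintype ι] [DecidableEq ι] {n : ℕ}

omit [Fintype ι] [DecidableEq ι] [NumberField K] in
/-- `(cE)`'s hermitian form is `cH`: `hermOf (c • η) = c · hermOf η` (plumbing).
[cite: Lange2023AbelianVarietiesComplex, §1.2.2 Lemma 1.2.10] -/
private theorem hermOf_smul' (c : ℝ) (η : E [⋀^Fin 2]→L[ℝ] ℝ) (v w : E) :
    hermOf (c • η) v w = (c : ℂ) * hermOf η v w := by
  rw [hermOf_apply, hermOf_apply, ContinuousAlternatingMap.smul_apply,
    ContinuousAlternatingMap.smul_apply, smul_eq_mul, smul_eq_mul]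
  push_cast
  ring

omit [Fintype ι] [DecidableEq ι] [NumberField K] in
/-- `nω` is a Riemann form for `n ≥ 1` (the polarization `L^n`). [cite: Lange2023AbelianVarietiesComplex, §5.3.4 Exercise (1)] -/
private theorem isRiemannForm_natCast_smul' {Ψ : (ι → ℝ) ≃L[ℝ] E} {ω : E [⋀^Fin 2]→L[ℝ] ℝ}
    (hω : IsRiemannForm Ψ ω) {c : ℕ} (hc : 0 < c) : IsRiemannForm Ψ ((c : ℝ) • ω) := by
  refine ⟨fun u v ↦ ?_, fun m m' ↦ ?_, fun u hu ↦ ?_⟩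
  · rw [ContinuousAlternatingMap.smul_apply, ContinuousAlternatingMap.smul_apply, hω.1]
  · obtain ⟨k, hk⟩ := hω.2.1 m m'
    exact ⟨c * k, by rw [ContinuousAlternatingMap.smul_apply, hk, smul_eq_mul, Int.cast_mul,
      Int.cast_natCast]⟩
  · rw [ContinuousAlternatingMap.smul_apply, smul_eq_mul]
    exact mul_pos (Nat.cast_pos.mpr hc) (hω.2.2 u hu)

omit [Fintype ι] [DecidableEq ι] in
/-- `N((c)) = c²` in a quadratic field (`N_{K/ℚ}(c) = c^{[K:ℚ]}`). [folklore] -/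
private theorem absNorm_span_natCast (b : Basis (Fin 2) ℤ (𝓞 K)) (c : ℕ) :
    Ideal.absNorm (Ideal.span {(c : 𝓞 K)}) = c ^ 2 := by
  rw [Ideal.absNorm_span_singleton, ← map_natCast (algebraMap ℤ (𝓞 K)) c, Algebra.norm_algebraMap,
    NumberField.RingOfIntegers.rank, finrank_eq_two_of_basis b]
  simp

/-- **Validation of Remark 1 on `E_Rⁿ`: the polarization `c·h₀/α_R` is `(c)`-modular of degree
`N((c))^n = c^{2n}`.**  On `X = E/Γ ≅ ℂⁿ/(R × ⋯ × R) = E_Rⁿ` with the PRINCIPAL `ω₀`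
(`α·hermOf ω₀ (u, v) = ᵗ(Cu)(C̄v)`, "`(R^g, (1/α_R) h₀)` defines a polarized torus", unimodular) and
`c ≥ 1`: the polarization `c·ω₀` has hermitian lattice `(Γ^α, c·h₀)` with dual `c⁻¹Γ = (c)⁻¹Γ`, i.e.
it is `(c)`-MODULAR (M), and Remark 1 gives `|deg ρ_{c h₀}| = N((c))^n = c^{2n}` (as it must:
`det(c·G₀) = c^{2n} det G₀`). [cite: Narbonne2022PolarizedProductsCM, §2.3 Remark 1 and §2.2 Thm. 1 (proof: `(R^g, h₀)`)] -/
theorem exists_modular_span_natCast_smul [FiniteDimensional ℂ E] (b : Basis (Fin 2) ℤ (𝓞 K))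
    (hb : b 0 = 1) (hα : 0 < (φ (b 1 : K)).im) (Ψ : (ι → ℝ) ≃L[ℝ] E) (C : E ≃L[ℂ] (Fin n → ℂ))
    (hC : ∀ v : Fin n → ℂ, (∃ m : ι → ℤ, C (latticeVec Ψ m) = v) ↔
      ∀ i, v i ∈ ⇑φ '' (((1 : (FractionalIdeal (𝓞 K)⁰ K)ˣ) : FractionalIdeal (𝓞 K)⁰ K) : Set K))
    {c : ℕ} (hc : 0 < c) :
    ∃ ω₀ : E [⋀^Fin 2]→L[ℝ] ℝ, IsPrincipalPolarization Ψ ω₀ ∧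
      IsRiemannForm Ψ ((c : ℝ) • ω₀) ∧
      (∀ v : E, (∀ m : ι → ℤ, ((φ (b 1 : K)).im : ℂ) * hermOf ((c : ℝ) • ω₀) v (latticeVec Ψ m) ∈
          (φ.comp (algebraMap (𝓞 K) K)).range) ↔
        ∀ s ∈ Ideal.span {(c : 𝓞 K)}, ∃ m : ι → ℤ, φ (s : K) • v = latticeVec Ψ m) ∧
      |polarizationDegree Ψ ((c : ℝ) • ω₀)| = (c : ℝ) ^ (2 * n) := by
  have hφ : (φ (b 1 : K)).im ≠ 0 := hα.ne'
  obtain ⟨ω₀, hω₀, -⟩ := exists_isPrincipalPolarization_of_image_eq_pi_one φ b hb hα Ψ C hC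
  have hΛ := smul_latticeVec_of_image_eq_pi φ (fun _ : Fin n ↦ (1 : (FractionalIdeal (𝓞 K)⁰ K)ˣ)) C hC
  obtain ⟨hR, huni⟩ := (isPrincipalPolarization_iff_forall_exists_intVec φ b hb hφ Ψ hΛ ω₀).1 hω₀
  have hRc : IsRiemannForm Ψ ((c : ℝ) • ω₀) := isRiemannForm_natCast_smul' hR hc
  -- `v ∈ dual of (Γ^α, c h₀) ⟺ c·v ∈ (Γ^α)^♯ (for h₀) ⟺ c·v ∈ Γ`
  have hdual : ∀ v : E, (∀ m : ι → ℤ, ((φ (b 1 : K)).im : ℂ) * hermOf ((c : ℝ) • ω₀) v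
      (latticeVec Ψ m) ∈ (φ.comp (algebraMap (𝓞 K) K)).range) ↔
      ∃ m : ι → ℤ, (c : ℂ) • v = latticeVec Ψ m := by
    intro v
    have hrew : ∀ m : ι → ℤ, ((φ (b 1 : K)).im : ℂ) * hermOf ((c : ℝ) • ω₀) v (latticeVec Ψ m) =
        ((φ (b 1 : K)).im : ℂ) * hermOf ω₀ ((c : ℂ) • v) (latticeVec Ψ m) := fun m ↦ by
      rw [hermOf_smul', hermOf_smul_left, Complex.ofReal_natCast]
    simp_rw [hrew]
    constructor
    · intro h
      obtain ⟨k, hk⟩ := huni (Ψ.symm ((c : ℂ) • v))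
        (by simpa only [ContinuousLinearEquiv.apply_symm_apply] using h)
      refine ⟨k, ?_⟩
      rw [show latticeVec Ψ k = Ψ (intVec k) from rfl, ← hk, ContinuousLinearEquiv.apply_symm_apply]
    · rintro ⟨k, hk⟩ m
      rw [hk]
      exact hR.mul_hermOf_latticeVec_mem φ b hb hφ hΛ k m
  -- `(c)`-modularity (M)
  have hmod : ∀ v : E, (∀ m : ι → ℤ, ((φ (b 1 : K)).im : ℂ) * hermOf ((c : ℝ) • ω₀) v
      (latticeVec Ψ m) ∈ (φ.comp (algebraMap (𝓞 K) K)).range) ↔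
      ∀ s ∈ Ideal.span {(c : 𝓞 K)}, ∃ m : ι → ℤ, φ (s : K) • v = latticeVec Ψ m := by
    intro v
    rw [hdual]
    constructor
    · rintro ⟨k, hk⟩ s hs
      obtain ⟨r, rfl⟩ := Ideal.mem_span_singleton'.mp hs
      obtain ⟨k', hk'⟩ := hΛ r k
      refine ⟨k', ?_⟩
      rw [← hk', ← hk, smul_smul]
      congr 1
      simp [map_natCast]
    · intro h
      obtain ⟨k, hk⟩ := h (c : 𝓞 K) (Ideal.mem_span_singleton_self _)
      refine ⟨k, ?_⟩
      rw [← hk]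
      congr 1
      simp [map_natCast]
  refine ⟨ω₀, hω₀, hRc, hmod, ?_⟩
  have hc0 : Ideal.span {(c : 𝓞 K)} ≠ ⊥ := by
    rw [Ne, Ideal.span_singleton_eq_bot]
    exact_mod_cast hc.ne'
  rw [abs_polarizationDegree_eq_absNorm_pow_of_modular φ b hb hφ hRc hΛ hc0 hmod,
    absNorm_span_natCast b, C.finrank_eq, Module.finrank_fin_fun, pow_mul]
  push_cast
  ring

end Standard

end ComplexTorus

end Literature.Geometry.Kaehler
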